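import Summits.NavierStokesRegularity.NavierStokesRegularity.Theses.AxisymmetricExtremality
import Summits.NavierStokesRegularity.NavierStokesRegularity.Theorems.AxisymmetricExtremalityAxisymmetricKatoGlobalStubSereginLogSwirlOriginStep3LocalKeyEstimate0
import Summits.NavierStokesRegularity.NavierStokesRegularity.Theorems.AxisymmetricExtremalityAxisymmetricKatoGlobalStubSereginLogSwirlOriginStep3LocalFamiliesW
import Summits.NavierStokesRegularity.NavierStokesRegularity.Theorems.AxisymmetricExtremalityAxisymmetricKatoGlobalStubSereginLogSwirlOriginStep4Assembly
import HarnessLib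

/-!
# Seregin 2022, §2 Step 3 for the LOCAL smooth class (XI): the key estimate for a family of
# smooth axisymmetric fields with uniform-in-`x` time moduli solving the vorticity equation near
# the cut-off — crux stmt-NavierStokesRegularity-15453
# (`AxisymmetricExtremality.AxisymmetricKatoGlobal`), line registered, support for stub `stub_sereginLogSwirlOrigin`

Support file (`--supports stmt-NavierStokesRegularity-15453`; theorems only, everything proved)
toward the registered stub `stub_sereginLogSwirlOrigin` = the named fact
`Literature.Analysis.FluidPDE.seregin2022_logSwirl_regularAtOrigin` (G. Seregin, J. Math. Fluid
Mech. 24 (2022), Paper 27 = arXiv:2201.00153, §2). This is the top of the local-class port of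
Step 3. The landed key estimate `cutoff_energy_keyEstimate_unconditional` (`…Step3KeyUnconditional`)
is stated for a whole-space classical solution `IsClassicalNSSolutionOn (Ioo a b) ν 0 v q`,
whereas the first-singular-time reduction of the fact supplies only the Seregin–Zajaczkowski
representative `V` on an open cylinder (no `∂ₜV`, no regular pressure); the sibling files prove
the same estimate for a family `v` of globally `C^∞` axisymmetric fields which is divergence
free and solves the VORTICITY equation pointwise off the axis on an open `W ⊇ K ⊇ supp ζ`, given
the joint continuity of `Γ, ∇Γ, ∂ₜΓ, Φ, ∇Φ, ∂ₜΦ` (`cutoff_energy_keyEstimate_local_unconditional`).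
Here that regularity is discharged from the time regularity the representative actually has:

* `continuousOn_quotient_families` — for `v` with smooth slices supported in a fixed ball and
  uniform-in-`x` time moduli of all `D_xᵏv` (`cutoffFamily_package`, `…Step3LocalCutoff`), the
  six families `Γ = angVortQuot`, `∂ₜΓ = angVelQuot W`, `∇Γ`, `Φ = radVelQuot ∘ curl`,
  `∂ₜΦ = radVelQuot W`, `∇Φ` are jointly continuous on the slab (`continuousOn_radQuot_family`
  applied to `swirl (curl v)`, `⟪x_h, curl v⟫`, `swirl W`, `⟪x_h, W⟫`, whose moduli come from
  `unifTime_curl`, `unifTime_vorticityRHS` and `unifTime_bilinear` with the pairings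
  `⟪Jy, ·⟫`, `⟪y_h, ·⟫`);
* `cutoff_energy_keyEstimate_local_of_moduli` (registered sub-goal) — **the Step-3 key estimate
  of Seregin 2022 for the local smooth class** (arXiv p. 7: "`sup_{-1<t<0}∫_𝒞 η⁶(|Γ|² + |Φ|²)dx +
  ∫_Q (η³|∇Φ|)² + (η³|∇Γ|)² dxdt ≤ C(v,η,r₁)`"): hypotheses = those of
  `cutoff_energy_keyEstimate_unconditional` ((2.2) with `C₁` on `r < r₁`, the far-field bound
  `M`, the cut-off bound `Bcut`, the pointwise constants `P₀, …, P₄` on `supp ∇ζ ∪ {r ≥ r₁}`,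
  `|B̄(0,2)| ≤ V`, the smallness `8C₁/ln(e/r₁) + 13C₁/ln²(e/r₁) + 4ε < 2ν`) with the classical
  solution replaced by: globally `C^∞` axisymmetric slices vanishing off `B̄(0, R)`, uniform-in-`x`
  time moduli of all `D_xᵏv`, `div v = 0` and the pointwise vorticity equation off the axis on an
  open `W ⊇ K`, `K` compact with `ζ = 0` off `K`. Conclusion and constant
  `K = E(t₁) + (Bcut + (12C₁(P₃² + P₄²)V/L² + ((P₀² + P₁²)/(2ε) + 2P₂)V) + 4MV)(t₂ − t₁)` verbatim,
  the gradients written as `‖∇·‖²` (`norm_fderiv_sq_eq_sum_sq`).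

With `cutoffFamily_package` (for `v = χV`, `χ = 1` on `𝒞(r₀) ⊇ supp η`, where `v = V`) this is
the Step-3 input of the Step-4 assembly (`cubicC_le_of_keyEstimate`) for the representative.

## Mathlib / tree search

Tree: `cutoff_energy_keyEstimate_local_unconditional` (`…Step3LocalKeyEstimate0`),
`continuousOn_radQuot_family`, `unifTime_curl`, `unifTime_bilinear` (`…Step3LocalFamilies`),
`unifTime_vorticityRHS`, `unifTime_fderiv`, `fderiv_eq_zero_of_forall_norm_gt`,
`curl_eq_zero_of_forall_norm_gt` (`…Step3LocalFamiliesW`), `contDiff_vorticityRHS`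
(`…Step3LocalEquations`), `norm_fderiv_sq_eq_sum_sq` (`…Step4Assembly`), `swirl_eq_inner_rotGen`,
`rotGenL`, `contDiff_horizontal_inner`, `contDiff_swirl`. Mathlib: `innerSL_apply_apply`,
`EuclideanSpace.inner_single_left`, `laplacian_const`, `InnerProductSpace.laplacian_congr_nhds`.
`lean search 'keyEstimate_local_of_moduli|quotient_families' --decl`: no matches (2026-08-17).

## References

* G. Seregin, J. Math. Fluid Mech. 24 (2022), Paper No. 27 = arXiv:2201.00153, §2 Step 3
  (arXiv p. 7, the key estimate). [`Seregin2022LocalAxisym`]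
-/

noncomputable section

open MeasureTheory Set Filter Topology Function Metric intervalIntegral
open scoped ENNReal ContDiff Laplacian RealInnerProductSpace
open Literature.Analysis.FluidPDE

-- `<Problem> = <Summit>` duplicates a namespace component by design (lakefile sets the same option).
set_option linter.dupNamespace false

namespace Summit.NavierStokesRegularity.NavierStokesRegularity.Theorems.AxisymmetricKatoGlobal.EulerScaling

/-! ### The six jointly continuous families from the time moduli -/

section Families

/-- **Joint continuity of `Γ, ∂ₜΓ, ∇Γ, Φ, ∂ₜΦ, ∇Φ` from uniform-in-`x` time moduli.** Let `v` have
globally `C^∞` slices on `S`, supported in `B̄(0, R)`, with uniform-in-`y` time moduli of every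
`D_yᵏ v` on `S`. Then the families `angVortQuot (v t)`, `angVelQuot W(t)`, `D(angVortQuot (v t))`,
`radVelQuot (curl (v t))`, `radVelQuot W(t)`, `D(radVelQuot (curl (v t)))`
(`W(t) = νΔ(curl v t) − D(curl v t)[v t] + D(v t)[curl v t]`) are jointly continuous on `S × ℝ³`
— the regularity hypotheses of `cutoff_energy_keyEstimate_local_unconditional`. [folklore] -/
theorem continuousOn_quotient_families {S : Set ℝ}
    {v : ℝ → EuclideanSpace ℝ (Fin 3) → EuclideanSpace ℝ (Fin 3)} {ν R : ℝ}
    (hu : ∀ t ∈ S, ContDiff ℝ ∞ (v t)) (hR : ∀ t ∈ S, ∀ y, R < ‖y‖ → v t y = 0)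
    (hU : ∀ k : ℕ, ∀ t ∈ S, ∀ ε > 0, ∃ δ > 0, ∀ t' ∈ S, |t' - t| < δ → ∀ y,
      ‖iteratedFDeriv ℝ k (v t') y - iteratedFDeriv ℝ k (v t) y‖ ≤ ε) :
    ContinuousOn (fun z : ℝ × EuclideanSpace ℝ (Fin 3) => angVortQuot (v z.1) z.2) (S ×ˢ univ) ∧
    ContinuousOn (fun z : ℝ × EuclideanSpace ℝ (Fin 3) => angVelQuot (fun y => ν • (Δ (curl (v z.1))) y - fderiv ℝ (curl (v z.1)) y (v z.1 y) + fderiv ℝ (v z.1) y (curl (v z.1) y)) z.2) (S ×ˢ univ) ∧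
    ContinuousOn (fun z : ℝ × EuclideanSpace ℝ (Fin 3) => fderiv ℝ (angVortQuot (v z.1)) z.2) (S ×ˢ univ) ∧
    ContinuousOn (fun z : ℝ × EuclideanSpace ℝ (Fin 3) => radVelQuot (curl (v z.1)) z.2) (S ×ˢ univ) ∧
    ContinuousOn (fun z : ℝ × EuclideanSpace ℝ (Fin 3) => radVelQuot (fun y => ν • (Δ (curl (v z.1))) y - fderiv ℝ (curl (v z.1)) y (v z.1 y) + fderiv ℝ (v z.1) y (curl (v z.1) y)) z.2) (S ×ˢ univ) ∧
    ContinuousOn (fun z : ℝ × EuclideanSpace ℝ (Fin 3) => fderiv ℝ (radVelQuot (curl (v z.1))) z.2) (S ×ˢ univ) := by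
  -- name the right-hand side family
  obtain ⟨Wf, hWf⟩ : ∃ Wf : ℝ → EuclideanSpace ℝ (Fin 3) → EuclideanSpace ℝ (Fin 3),
      ∀ t, Wf t = fun y => ν • (Δ (curl (v t))) y - fderiv ℝ (curl (v t)) y (v t y) + fderiv ℝ (v t) y (curl (v t) y) := ⟨_, fun _ => rfl⟩
  have hω : ∀ t ∈ S, ContDiff ℝ ∞ (curl (v t)) := fun t ht => contDiff_curl (n := ⊤) (by exact_mod_cast hu t ht)
  have hWs : ∀ t ∈ S, ContDiff ℝ ∞ (Wf t) := fun t ht => by rw [hWf]; exact contDiff_vorticityRHS (hu t ht) ν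
  have hωR : ∀ t ∈ S, ∀ y, R < ‖y‖ → curl (v t) y = 0 := fun t ht y hy => curl_eq_zero_of_forall_norm_gt (hR t ht) hy
  have hWR : ∀ t ∈ S, ∀ y, R < ‖y‖ → Wf t y = 0 := by
    intro t ht y hy
    have hopen : IsOpen {z : EuclideanSpace ℝ (Fin 3) | R < ‖z‖} := isOpen_lt continuous_const continuous_norm
    have hcurl : curl (v t) =ᶠ[𝓝 y] fun _ => (0 : EuclideanSpace ℝ (Fin 3)) := by
      filter_upwards [hopen.mem_nhds hy] with z hz using hωR t ht z hz
    have hΔ : (Δ (curl (v t))) y = 0 := by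
      rw [(InnerProductSpace.laplacian_congr_nhds hcurl).self_of_nhds, InnerProductSpace.laplacian_const, Pi.zero_apply]
    rw [hWf]
    show ν • (Δ (curl (v t))) y - fderiv ℝ (curl (v t)) y (v t y) + fderiv ℝ (v t) y (curl (v t) y) = 0
    rw [hΔ, fderiv_eq_zero_of_forall_norm_gt (hωR t ht) hy, hωR t ht y hy, smul_zero, map_zero]
    simp
  -- moduli of `ω` and `W`
  have hUω := unifTime_curl hu hU
  have hUW : ∀ k : ℕ, ∀ t ∈ S, ∀ ε > 0, ∃ δ > 0, ∀ t' ∈ S, |t' - t| < δ → ∀ y,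
      ‖iteratedFDeriv ℝ k (Wf t') y - iteratedFDeriv ℝ k (Wf t) y‖ ≤ ε := by
    intro k t ht ε hε
    obtain ⟨δ, hδ, h⟩ := unifTime_vorticityRHS S v ν R hu hR hU k t ht ε hε
    exact ⟨δ, hδ, fun t' ht' hlt y => by rw [hWf t', hWf t]; exact h t' ht' hlt y⟩
  -- the two pairings `⟪Jy, w⟫` and `⟪y_h, w⟫ = ⟪P y, w⟫`
  set P : EuclideanSpace ℝ (Fin 3) →L[ℝ] EuclideanSpace ℝ (Fin 3) :=
    (EuclideanSpace.proj (0 : Fin 3) : EuclideanSpace ℝ (Fin 3) →L[ℝ] ℝ).smulRight (EuclideanSpace.single 0 1) +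
      (EuclideanSpace.proj (1 : Fin 3) : EuclideanSpace ℝ (Fin 3) →L[ℝ] ℝ).smulRight (EuclideanSpace.single 1 1) with hP
  have hPinner : ∀ (y w : EuclideanSpace ℝ (Fin 3)), ⟪P y, w⟫ = y 0 * w 0 + y 1 * w 1 := fun y w => by
    simp [hP, inner_add_left, inner_smul_left, EuclideanSpace.inner_single_left]
  have eS : ∀ w : EuclideanSpace ℝ (Fin 3) → EuclideanSpace ℝ (Fin 3),
      swirl w = fun y => innerSL ℝ (rotGenL y) (w y) := fun w => by
    rw [swirl_eq_inner_rotGen]; rfl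
  have eH : ∀ w : EuclideanSpace ℝ (Fin 3) → EuclideanSpace ℝ (Fin 3),
      (fun y : EuclideanSpace ℝ (Fin 3) => y 0 * w y 0 + y 1 * w y 1) = fun y => innerSL ℝ (P y) (w y) := fun w => by
    funext y; rw [innerSL_apply_apply, hPinner]
  -- constant left families have trivial moduli
  have hconst : ∀ (L : EuclideanSpace ℝ (Fin 3) →L[ℝ] EuclideanSpace ℝ (Fin 3)),
      ∀ k : ℕ, ∀ t ∈ S, ∀ ε > 0, ∃ δ > 0, ∀ t' ∈ S, |t' - t| < δ → ∀ y,
        ‖iteratedFDeriv ℝ k ((fun (_ : ℝ) (y : EuclideanSpace ℝ (Fin 3)) => L y) t') y -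
          iteratedFDeriv ℝ k ((fun (_ : ℝ) (y : EuclideanSpace ℝ (Fin 3)) => L y) t) y‖ ≤ ε :=
    fun L k t _ ε hε => ⟨1, one_pos, fun t' _ _ y => by rw [sub_self, norm_zero]; exact hε.le⟩
  have hLs : ∀ (L : EuclideanSpace ℝ (Fin 3) →L[ℝ] EuclideanSpace ℝ (Fin 3)), ∀ t ∈ S,
      ContDiff ℝ ∞ ((fun (_ : ℝ) (y : EuclideanSpace ℝ (Fin 3)) => L y) t) := fun L _ _ => L.contDiff
  -- moduli of the four scalar families
  have mk : ∀ {w : ℝ → EuclideanSpace ℝ (Fin 3) → EuclideanSpace ℝ (Fin 3)} (L : EuclideanSpace ℝ (Fin 3) →L[ℝ] EuclideanSpace ℝ (Fin 3)),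
      (∀ t ∈ S, ContDiff ℝ ∞ (w t)) → (∀ t ∈ S, ∀ y, R < ‖y‖ → w t y = 0) →
      (∀ k : ℕ, ∀ t ∈ S, ∀ ε > 0, ∃ δ > 0, ∀ t' ∈ S, |t' - t| < δ → ∀ y,
        ‖iteratedFDeriv ℝ k (w t') y - iteratedFDeriv ℝ k (w t) y‖ ≤ ε) →
      ∀ k : ℕ, ∀ t ∈ S, ∀ ε > 0, ∃ δ > 0, ∀ t' ∈ S, |t' - t| < δ → ∀ y,
        ‖iteratedFDeriv ℝ k (fun y => innerSL ℝ (L y) (w t' y)) y -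
          iteratedFDeriv ℝ k (fun y => innerSL ℝ (L y) (w t y)) y‖ ≤ ε :=
    fun L hw hwR hUw => unifTime_bilinear (S := S) (innerSL ℝ) (f := fun (_ : ℝ) y => L y) (hLs L) hw hwR (hconst L) hUw
  have hUΓ : ∀ k : ℕ, k = 2 ∨ k = 3 → ∀ t ∈ S, ∀ ε > 0, ∃ δ > 0, ∀ t' ∈ S, |t' - t| < δ → ∀ y,
      ‖iteratedFDeriv ℝ k (swirl (curl (v t'))) y - iteratedFDeriv ℝ k (swirl (curl (v t))) y‖ ≤ ε := by
    intro k _ t ht ε hε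
    obtain ⟨δ, hδ, h⟩ := mk rotGenL hω hωR hUω k t ht ε hε
    exact ⟨δ, hδ, fun t' ht' hlt y => by rw [eS, eS]; exact h t' ht' hlt y⟩
  have hUΓ' : ∀ k : ℕ, k = 2 ∨ k = 3 → ∀ t ∈ S, ∀ ε > 0, ∃ δ > 0, ∀ t' ∈ S, |t' - t| < δ → ∀ y,
      ‖iteratedFDeriv ℝ k (swirl (Wf t')) y - iteratedFDeriv ℝ k (swirl (Wf t)) y‖ ≤ ε := by
    intro k _ t ht ε hε
    obtain ⟨δ, hδ, h⟩ := mk rotGenL hWs hWR hUW k t ht ε hε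
    exact ⟨δ, hδ, fun t' ht' hlt y => by rw [eS, eS]; exact h t' ht' hlt y⟩
  have hUJ : ∀ k : ℕ, k = 2 ∨ k = 3 → ∀ t ∈ S, ∀ ε > 0, ∃ δ > 0, ∀ t' ∈ S, |t' - t| < δ → ∀ y,
      ‖iteratedFDeriv ℝ k (fun y : EuclideanSpace ℝ (Fin 3) => y 0 * curl (v t') y 0 + y 1 * curl (v t') y 1) y -
        iteratedFDeriv ℝ k (fun y : EuclideanSpace ℝ (Fin 3) => y 0 * curl (v t) y 0 + y 1 * curl (v t) y 1) y‖ ≤ ε := by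
    intro k _ t ht ε hε
    obtain ⟨δ, hδ, h⟩ := mk P hω hωR hUω k t ht ε hε
    exact ⟨δ, hδ, fun t' ht' hlt y => by rw [eH, eH]; exact h t' ht' hlt y⟩
  have hUJ' : ∀ k : ℕ, k = 2 ∨ k = 3 → ∀ t ∈ S, ∀ ε > 0, ∃ δ > 0, ∀ t' ∈ S, |t' - t| < δ → ∀ y,
      ‖iteratedFDeriv ℝ k (fun y : EuclideanSpace ℝ (Fin 3) => y 0 * Wf t' y 0 + y 1 * Wf t' y 1) y -
        iteratedFDeriv ℝ k (fun y : EuclideanSpace ℝ (Fin 3) => y 0 * Wf t y 0 + y 1 * Wf t y 1) y‖ ≤ ε := by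
    intro k _ t ht ε hε
    obtain ⟨δ, hδ, h⟩ := mk P hWs hWR hUW k t ht ε hε
    exact ⟨δ, hδ, fun t' ht' hlt y => by rw [eH, eH]; exact h t' ht' hlt y⟩
  -- the radial quotients
  obtain ⟨cΓ, cDΓ⟩ := continuousOn_radQuot_family S (fun t => swirl (curl (v t)))
    (fun t ht => contDiff_swirl (hω t ht)) hUΓ
  obtain ⟨cΓ', -⟩ := continuousOn_radQuot_family S (fun t => swirl (Wf t))
    (fun t ht => contDiff_swirl (hWs t ht)) hUΓ'
  obtain ⟨cJ, cDJ⟩ := continuousOn_radQuot_family S (fun t => fun y : EuclideanSpace ℝ (Fin 3) => y 0 * curl (v t) y 0 + y 1 * curl (v t) y 1)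
    (fun t ht => contDiff_horizontal_inner (hω t ht)) hUJ
  obtain ⟨cJ', -⟩ := continuousOn_radQuot_family S (fun t => fun y : EuclideanSpace ℝ (Fin 3) => y 0 * Wf t y 0 + y 1 * Wf t y 1)
    (fun t ht => contDiff_horizontal_inner (hWs t ht)) hUJ'
  refine ⟨cΓ, ?_, cDΓ, cJ, ?_, cDJ⟩
  · refine cΓ'.congr fun z _ => ?_
    show angVelQuot _ z.2 = radQuot (swirl (Wf z.1)) z.2
    rw [hWf]; rfl
  · refine cJ'.congr fun z _ => ?_
    show radVelQuot _ z.2 = radQuot (fun y : EuclideanSpace ℝ (Fin 3) => y 0 * Wf z.1 y 0 + y 1 * Wf z.1 y 1) z.2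
    rw [hWf]; rfl

end Families

/-! ### The key estimate for the local class, from the time moduli -/

set_option maxHeartbeats 800000 in
/-- **Seregin 2022, §2 Step 3 — the key estimate for the LOCAL smooth class** (arXiv p. 7:
"`sup_{-1<t<0}∫_𝒞 η⁶(|Γ|² + |Φ|²)dx + ∫_Q (η³|∇Φ|)² + (η³|∇Γ|)² dxdt ≤ C(v,η,r₁)`"), in the
form needed after the first-singular-time reduction of the fact: the statement of
`cutoff_energy_keyEstimate_unconditional` with the whole-space classical solution replaced by a
family `v` of globally `C^∞` axisymmetric fields on `(a, b)` vanishing off `B̄(0, R)`, with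
uniform-in-`x` time moduli of all `D_xᵏv` (the cut-off globalisation `χV` of the
Seregin–Zajaczkowski representative, `cutoffFamily_package`), divergence free and solving the
vorticity equation pointwise off the axis on an open `W` containing the compact `K` off which
`ζ` vanishes. Hypotheses (2.2)/`M`/`Bcut`/`P₀…P₄`/`V`/smallness and the conclusion with its
constant `K = E(t₁) + (Bcut + (12C₁(P₃²+P₄²)V/L² + ((P₀²+P₁²)/(2ε) + 2P₂)V) + 4MV)(t₂ − t₁)`,
`L = ln(e/r₁)`, verbatim (gradients as `‖∇·‖²`). Registered sub-goal toward
`stub_sereginLogSwirlOrigin`. [cite: Seregin2022LocalAxisym, §2 Step 3 (arXiv:2201.00153 p. 7, the key estimate) and Lemma 2.1 (p. 5)] -/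
theorem cutoff_energy_keyEstimate_local_of_moduli : ∀ (a b ν : ℝ) (v : ℝ → EuclideanSpace ℝ (Fin 3) → EuclideanSpace ℝ (Fin 3)) (ζ : ℝ → EuclideanSpace ℝ (Fin 3) → ℝ) (K W : Set (EuclideanSpace ℝ (Fin 3))) (R t₁ t₂ C₁ r₁ M Bcut ε P₀ P₁ P₂ P₃ P₄ V : ℝ), (∀ s ∈ Ioo a b, ContDiff ℝ (⊤ : ℕ∞) (v s)) → (∀ s ∈ Ioo a b, IsAxisymmetric (v s)) → 0 ≤ ν → IsSmoothSpaceTimeOn (Ioo a b) ζ → (∀ s ∈ Ioo a b, IsAxisymmetricScalar (ζ s)) → (∀ s ∈ Ioo a b, tsupport (ζ s) ⊆ SereginSverak2009.spaceCyl 0 1) → Icc t₁ t₂ ⊆ Ioo a b → IsCompact K → (∀ s ∈ Ioo a b, ∀ x ∉ K, ζ s x = 0) → IsOpen W → K ⊆ W → (∀ s ∈ Ioo a b, ∀ x ∈ W, VectorCalculus.divergence (v s) x = 0) → (∀ s ∈ Ioo a b, ∀ x ∈ W, cylRadius x ≠ 0 → HasDerivAt (fun s' => curl (v s') x) (ν •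 (Δ (curl (v s))) x - fderiv ℝ (curl (v s)) x (v s x) + fderiv ℝ (v s) x (curl (v s) x)) s) → (∀ t ∈ Ioo a b, ∀ y, R < ‖y‖ → v t y = 0) → (∀ k : ℕ, ∀ t ∈ Ioo a b, ∀ ε > 0, ∃ δ > 0, ∀ t' ∈ Ioo a b, |t' - t| < δ → ∀ y, ‖iteratedFDeriv ℝ k (v t') y - iteratedFDeriv ℝ k (v t) y‖ ≤ ε) → t₁ ≤ t₂ → 0 ≤ C₁ → 0 < r₁ → r₁ < 1 → 0 ≤ M → 0 ≤ Bcut → 0 < ε → 0 ≤ P₂ → volume.real (closedBall (0 : EuclideanSpace ℝ (Fin 3)) 2) ≤ V → (∀ t ∈ Icc t₁ t₂, ∀ x, 0 < cylRadius x → cylRadius x < r₁ → |swirl (v t) x| ≤ C₁ / Real.log (Real.exp 1 / cylRadius x) ^ 3) → (∀ t ∈ Icc t₁ t₂, ∀ x, r₁ ≤ cylRadius x → |angVelQuot (v t) x * (ζ t x * angVortQuot (v t) x) * (ζ t x * radVelQuot (curl (v t)) x)| ≤ M) → (∀ t ∈ Icc t₁ t₂, (2 * (∫ x, ζ t x * timeDerivWithin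 (Ioo a b) ζ t x * angVortQuot (v t) x ^ 2) + 2 * (∫ x, ζ t x * angVortQuot (v t) x ^ 2 * fderiv ℝ (ζ t) x (v t x)) + 2 * ν * (∫ x, angVortQuot (v t) x ^ 2 * ‖fderiv ℝ (ζ t) x‖ ^ 2) - 4 * ν * (∫ x, ζ t x * angVortQuot (v t) x ^ 2 * radDerivQuot (ζ t) x)) + (2 * (∫ x, ζ t x * timeDerivWithin (Ioo a b) ζ t x * radVelQuot (curl (v t)) x ^ 2) + 2 * (∫ x, ζ t x * radVelQuot (curl (v t)) x ^ 2 * fderiv ℝ (ζ t) x (v t x)) + 2 * ν * (∫ x, radVelQuot (curl (v t)) x ^ 2 * ‖fderiv ℝ (ζ t) x‖ ^ 2) - 4 * ν * (∫ x, ζ t x * radVelQuot (curl (v t)) x ^ 2 * radDerivQuot (ζ t) x)) ≤ Bcut) → (∀ t ∈ Icc t₁ t₂, ∀ x, r₁ ≤ cylRadius x → |swirlVelocity (v t) x| * ‖fderiv ℝ (fun y => ζ t y * radVelQuot (v t) y) x‖ ≤ P₀) → (∀ t ∈ Icc t₁ t₂, ∀ x, |radVelQuot (v t) x| * |swirlVelocity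 (v t) x| * ‖fderiv ℝ (ζ t) x‖ ≤ P₁) → (∀ t ∈ Icc t₁ t₂, ∀ x, |ζ t x * radVelQuot (curl (v t)) x| * |swirlVelocity (v t) x| * (‖fderiv ℝ (ζ t) x‖ * ‖fderiv ℝ (radVelQuot (v t)) x‖) ≤ P₂) → (∀ t ∈ Icc t₁ t₂, ∀ x, fderiv ℝ (ζ t) x ≠ 0 → |fderiv ℝ (fun y => fderiv ℝ (ζ t) y (EuclideanSpace.single 2 1) * radVelQuot (v t) y - radDerivQuot (ζ t) y * v t y 2) x (EuclideanSpace.single 2 1)| ≤ P₃) → (∀ t ∈ Icc t₁ t₂, ∀ x, fderiv ℝ (ζ t) x ≠ 0 → |radDerivQuot (fun y => fderiv ℝ (ζ t) y (v t y)) x| ≤ P₄) → 8 * C₁ / Real.log (Real.exp 1 / r₁) + (13 * C₁ / Real.log (Real.exp 1 / r₁) ^ 2 + 4 * ε) < 2 * ν → (∀ t ∈ Icc t₁ t₂, (∫ x, (ζ t x * angVortQuot (v t) x) ^ 2) + (∫ x, (ζ t x * radVelQuot (curl (v t)) x) ^ 2) ≤ (∫ x, (ζ t₁ x * angVortQuot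 (v t₁) x) ^ 2) + (∫ x, (ζ t₁ x * radVelQuot (curl (v t₁)) x) ^ 2) + (Bcut + (12 * C₁ * (P₃ ^ 2 + P₄ ^ 2) * V / Real.log (Real.exp 1 / r₁) ^ 2 + ((P₀ ^ 2 + P₁ ^ 2) / (2 * ε) + 2 * P₂) * V) + 4 * M * V) * (t₂ - t₁)) ∧ ∫ s in t₁..t₂, ((∫ x, ‖fderiv ℝ (fun y => ζ s y * angVortQuot (v s) y) x‖ ^ 2) + (∫ x, ‖fderiv ℝ (fun y => ζ s y * radVelQuot (curl (v s)) y) x‖ ^ 2)) ≤ ((∫ x, (ζ t₁ x * angVortQuot (v t₁) x) ^ 2) + (∫ x, (ζ t₁ x * radVelQuot (curl (v t₁)) x) ^ 2) + (Bcut + (12 * C₁ * (P₃ ^ 2 + P₄ ^ 2) * V / Real.log (Real.exp 1 / r₁) ^ 2 + ((P₀ ^ 2 + P₁ ^ 2) / (2 * ε) + 2 * P₂) * V) + 4 * M * V) * (t₂ - t₁)) / (2 * ν - 8 * C₁ / Real.log (Real.exp 1 / r₁) - (13 * C₁ / Real.log (Real.exp 1 / r₁) ^ 2 + 4 * ε))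 := by
  intro a b ν v ζ K W R t₁ t₂ C₁ r₁ M Bcut ε P₀ P₁ P₂ P₃ P₄ V hu hax hν hζ hζax hζs hsub hK hsupp hWo hKW hdiv hvort hR hU h12 hC₁ hr₁ hr₁1 hM hBcut hε hP₂ hV hσ hfar hcut hP0 hP1 hP2 hP3 hP4 hsmall
  obtain ⟨hΓc, hΓ'c, hDΓc, hJc, hJ'c, hDJc⟩ := continuousOn_quotient_families (S := Ioo a b) (ν := ν) hu hR hU
  -- the cut-off bound in the coordinate form
  have hcut' : ∀ t ∈ Icc t₁ t₂, (2 * (∫ x, ζ t x * timeDerivWithin (Ioo a b) ζ t x * angVortQuot (v t) x ^ 2) + 2 * (∫ x, ζ t x * angVortQuot (v t) x ^ 2 * fderiv ℝ (ζ t) x (v t x)) + 2 * ν * (∫ x, angVortQuot (v t) x ^ 2 * (fderiv ℝ (ζ t) x (EuclideanSpace.single 0 1) ^ 2 + fderiv ℝ (ζ t) x (EuclideanSpace.single 1 1) ^ 2 + fderiv ℝ (ζ t) x (EuclideanSpace.single 2 1) ^ 2)) - 4 * ν * (∫ x, ζ t x * angVortQuot (v t) x ^ 2 * radDerivQuot (ζ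 t) x)) + (2 * (∫ x, ζ t x * timeDerivWithin (Ioo a b) ζ t x * radVelQuot (curl (v t)) x ^ 2) + 2 * (∫ x, ζ t x * radVelQuot (curl (v t)) x ^ 2 * fderiv ℝ (ζ t) x (v t x)) + 2 * ν * (∫ x, radVelQuot (curl (v t)) x ^ 2 * (fderiv ℝ (ζ t) x (EuclideanSpace.single 0 1) ^ 2 + fderiv ℝ (ζ t) x (EuclideanSpace.single 1 1) ^ 2 + fderiv ℝ (ζ t) x (EuclideanSpace.single 2 1) ^ 2)) - 4 * ν * (∫ x, ζ t x * radVelQuot (curl (v t)) x ^ 2 * radDerivQuot (ζ t) x)) ≤ Bcut := by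
    intro t ht
    simpa only [← norm_fderiv_sq_eq_sum_sq] using hcut t ht
  obtain ⟨hsup, hdiss⟩ := cutoff_energy_keyEstimate_local_unconditional a b ν v ζ K W t₁ t₂ C₁ r₁ M Bcut ε P₀ P₁ P₂ P₃ P₄ V
    hu hax hν hζ hζax hζs hsub hK hsupp hWo hKW hdiv hvort hΓc hΓ'c hDΓc hJc hJ'c hDJc h12 hC₁ hr₁ hr₁1 hM hBcut hε hP₂ hV hσ hfar hcut' hP0 hP1 hP2 hP3 hP4 hsmall
  refine ⟨hsup, ?_⟩
  simpa only [norm_fderiv_sq_eq_sum_sq] using hdiss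

end Summit.NavierStokesRegularity.NavierStokesRegularity.Theorems.AxisymmetricKatoGlobal.EulerScaling

end
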